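import Summits.PneNP.PneNP.Theorems.GapMCSPWindowCellZeroUnfolding

/-!
# Gap-MCSP window cell `q = 0` (trade-off law) — V. Variables, nodes and the root potential

Part of the tree landing of HOME/decomp-pnenp-lens-1/TradeOffLaw.lean (sha256 880b490f…, lens-1 g13 of the decomp-pnenp root-decomposition cell; critic NODE-VERDICT 2026-08-30T13:09:32Z CLEARED, landing endorsed (6)(a)):
a SIZE–ACCEPTANCE TRADE-OFF for every `B₂`-circuit on `N` inputs that accepts `0^N` and every point
indicator `e_p` — `N ≤ 9·L·(L + G + 3 − N)`, `L = ⌊log₂ acc⌋`, `G` = number of gates — and its payout: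
the Oliveira–Pich–Santhanam gap problem `Gap-MCSP[2^{βn}/(cn), 2^{βn}]` (census R3) is not separated by
`B₂`-circuit families of eventually `≤ N` gates (`0 < β < 1/3`, every `c ≥ 1`), i.e. the `q = 0` cell of
the window dial of route `route-PneNP-RootDecompMagnificationPayout` (item stmt-PneNP-33309 `WindowCellZero`,
BC5 rung for the attacked item stmt-PneNP-32096). Modules, in dependency order: `…Formulas` (rooted
`B₂`-formulas and additive valuations) → `…Counting` (uniform counting, silent/flipping variables, numeric
helpers) → `…FlipLaw` (the exact acceptance law for read-once formulas) → `…Unfolding` (rooted unfolding of a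
gate list, consistency, references) → `…Potential` (variables/nodes of unfoldings, the root potential: no
duplication across root formulas) → `…Relevance` (relevant roots, link, locality) → `…Product` (boxes, the two
exponent bounds, pigeonhole, the final arithmetic) → `…Count` (`t + 2·nocc ≤ 2G + 3`) → `GapMCSPWindowCellZero`
(the law proved, the payout in tree vocabulary). Proof-internal machinery: nothing here bears on P vs NP
beyond the S-free lower bound it proves; all statements are [folklore]-tagged kernel lemmas of the lens.

THIS FILE (lens §4, second part): variables of an unfolding are non-root inputs read at least once
(`vars_UR`), gate nodes are the gate itself or non-root gates read at least once (`nodes_UR`); the ROOT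
POTENTIAL `ΦR` of an arbitrary additive valuation and its exact evaluation (`ΦR_eq`: appending a gate adds
exactly its direct weight when non-root gates have fan-out `≤ 1`), hence NO DUPLICATION ACROSS ROOT FORMULAS:
`sum_root_val_le`, `sum_root_mult_le` (a non-root input occurs in all root unfoldings together at most as often
as it is read), `sum_root_gmult_le` (every gate index at most once).
-/

noncomputable section

set_option linter.dupNamespace false -- `Summit.PneNP.PneNP.…`: summit = sub-problem name (D-0017 single-conjunct layout)

namespace Summit.PneNP.PneNP.Theorems.GapMCSPWindowCellZero

open Literature.Computability.Complexity

section Potential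

open Finset
open Literature.Computability.Complexity.GateList

variable {N : ℕ}

namespace BF

variable (R : Fin N ⊕ ℕ → Bool)

/-- Variables of a rooted unfolding are non-root inputs that are read at least once. [folklore] -/
theorem vars_UR : ∀ gs : List (Gate (Fin N)), WFL gs →
    ∀ m p, p ∈ (UR R gs m).vars → R (.inl p) = false ∧ 1 ≤ reads gs p := by
  intro gs
  induction gs using List.reverseRecOn with
  | nil => intro _ m p hp; simp [UR, unfsR, vars] at hp
  | append_singleton gs g ih =>
    intro hwf m p hp
    have ih' := ih hwf.init
    have hmono : ∀ p, reads gs p ≤ reads (gs ++ [g]) p := fun p => by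
      rw [reads_append_singleton]; omega
    have hchild : ∀ a : Fin g.arity, ∀ p, p ∈ (childR R (unfsR R gs) (g.args a)).vars →
        R (.inl p) = false ∧ 1 ≤ reads (gs ++ [g]) p := by
      intro a p hp
      cases ha : g.args a with
      | inl i =>
        rw [ha, childR_inl] at hp
        split_ifs at hp with hR
        · simp [vars] at hp
        · simp only [vars, mem_singleton] at hp
          subst hp
          refine ⟨by simpa using hR, ?_⟩
          rw [reads_append_singleton]
          have := one_le_cntI ha
          omega
      | inr m₁ =>
        rw [ha, childR_inr] at hp
        split_ifs at hp with hR
        · simp [vars] at hp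
        · obtain ⟨h1, h2⟩ := ih' m₁ p hp
          exact ⟨h1, h2.trans (hmono p)⟩
    rcases Nat.lt_trichotomy m gs.length with hm | hm | hm
    · rw [UR_append_of_lt R g hm] at hp
      obtain ⟨h1, h2⟩ := ih' m p hp
      exact ⟨h1, h2.trans (hmono p)⟩
    · subst hm
      rw [UR_append_self] at hp
      rcases g with ⟨_ | _ | _ | k, op, args⟩
      · simp [unfOfR, vars] at hp
      · simp only [unfOfR, vars, mem_union] at hp
        rcases hp with hp | hp
        · exact hchild 0 p hp
        · simp at hp
      · simp only [unfOfR, vars, mem_union] at hp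
        rcases hp with hp | hp
        · exact hchild 0 p hp
        · exact hchild 1 p hp
      · simp [unfOfR, vars] at hp
    · rw [UR_of_le R (by simp; omega)] at hp
      simp [vars] at hp

/-- Gate nodes of the rooted unfolding of gate `m`: the gate itself, or non-root gates that are
read at least once; all of index `< length`. [folklore] -/
theorem nodes_UR : ∀ gs : List (Gate (Fin N)), WFL gs →
    ∀ m j, j ∈ (UR R gs m).nodes → j < gs.length ∧ (j = m ∨ (R (.inr j) = false ∧ 1 ≤ refL gs j)) := by
  intro gs
  induction gs using List.reverseRecOn with
  | nil => intro _ m j hj; simp [UR, unfsR, nodes] at hj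
  | append_singleton gs g ih =>
    intro hwf m j hj
    have ih' := ih hwf.init
    have hmono : ∀ j, refL gs j ≤ refL (gs ++ [g]) j := fun j => by
      rw [refL_append_singleton]; omega
    have hchild : ∀ a : Fin g.arity, ∀ j, j ∈ (childR R (unfsR R gs) (g.args a)).nodes →
        j < gs.length ∧ (R (.inr j) = false ∧ 1 ≤ refL (gs ++ [g]) j) := by
      intro a j hj
      cases ha : g.args a with
      | inl i =>
        rw [ha, childR_inl] at hj
        split_ifs at hj <;> simp [nodes] at hj
      | inr m₁ =>
        rw [ha, childR_inr] at hj
        split_ifs at hj with hR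
        · simp [nodes] at hj
        · obtain ⟨h1, h2⟩ := ih' m₁ j hj
          refine ⟨h1, ?_⟩
          rcases h2 with rfl | ⟨h3, h4⟩
          · refine ⟨by simpa using hR, ?_⟩
            rw [refL_append_singleton]
            have := one_le_cnt ha
            omega
          · exact ⟨h3, h4.trans (hmono j)⟩
    rcases Nat.lt_trichotomy m gs.length with hm | hm | hm
    · rw [UR_append_of_lt R g hm] at hj
      obtain ⟨h1, h2⟩ := ih' m j hj
      refine ⟨by simp; omega, ?_⟩
      rcases h2 with h2 | ⟨h3, h4⟩
      · exact Or.inl h2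
      · exact Or.inr ⟨h3, h4.trans (hmono j)⟩
    · subst hm
      rw [UR_append_self] at hj
      have fin : ∀ j, (j = gs.length ∨ ∃ a : Fin g.arity, j ∈ (childR R (unfsR R gs) (g.args a)).nodes) →
          j < (gs ++ [g]).length ∧ (j = gs.length ∨ (R (.inr j) = false ∧ 1 ≤ refL (gs ++ [g]) j)) := by
        rintro j (rfl | ⟨a, ha⟩)
        · exact ⟨by simp, Or.inl rfl⟩
        · obtain ⟨h1, h2⟩ := hchild a j ha
          exact ⟨by simp; omega, Or.inr h2⟩
      apply fin
      rcases g with ⟨_ | _ | _ | k, op, args⟩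
      · simp only [unfOfR, nodes, mem_insert, mem_union] at hj
        rcases hj with hj | hj | hj
        · exact Or.inl hj
        · simp at hj
        · simp at hj
      · simp only [unfOfR, nodes, mem_insert, mem_union] at hj
        rcases hj with hj | hj | hj
        · exact Or.inl hj
        · exact Or.inr ⟨0, hj⟩
        · simp at hj
      · simp only [unfOfR, nodes, mem_insert, mem_union] at hj
        rcases hj with hj | hj | hj
        · exact Or.inl hj
        · exact Or.inr ⟨0, hj⟩
        · exact Or.inr ⟨1, hj⟩
      · simp [unfOfR, nodes] at hj
    · rw [UR_of_le R (by simp; omega)] at hj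
      simp [nodes] at hj

/-! ### The root potential for an arbitrary additive valuation -/

/-- Effective fan-out: `0` for root gates, the fan-out otherwise. -/
def erefL (gs : List (Gate (Fin N))) (m : ℕ) : ℕ := if R (.inr m) then 0 else refL gs m

/-- The direct input weight of a gate: `ℓ i` for every slot wired to a NON-root input `i`. -/
def inpR (ℓ : Fin N → ℕ) (g : Gate (Fin N)) : ℕ :=
  ∑ a : Fin g.arity, (match g.args a with | .inl i => if R (.inl i) then 0 else ℓ i | .inr _ => 0)

/-- The ROOT POTENTIAL of the valuation `val ℓ κ`. [folklore] -/
def ΦR (ℓ : Fin N → ℕ) (κ : ℕ → ℕ) (gs : List (Gate (Fin N))) : ℕ :=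
  ∑ m ∈ range gs.length, (1 - erefL R gs m) * (UR R gs m).val ℓ κ

/-- `val` of a child formula: `0` at roots, the literal weight / the earlier unfolding's value otherwise. -/
theorem val_childR (ℓ : Fin N → ℕ) (κ : ℕ → ℕ) (gs : List (Gate (Fin N))) (w : Fin N ⊕ ℕ) :
    (childR R (unfsR R gs) w).val ℓ κ =
      (match w with
        | .inl i => if R (.inl i) then 0 else ℓ i
        | .inr m => if R (.inr m) then 0 else (UR R gs m).val ℓ κ) := by
  cases w with
  | inl i => rw [childR_inl]; split_ifs with h <;> simp [h]
  | inr m => rw [childR_inr]; split_ifs with h <;> simp [h]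

/-- `val` of the unfolding of one gate: its node weight plus the values of its children. -/
theorem val_unfOfR (ℓ : Fin N → ℕ) (κ : ℕ → ℕ) (gs : List (Gate (Fin N))) (g : Gate (Fin N))
    (hg : g.arity ≤ 2) (j : ℕ) :
    (unfOfR R j (unfsR R gs) g).val ℓ κ = κ j + ∑ a : Fin g.arity, (childR R (unfsR R gs) (g.args a)).val ℓ κ := by
  rcases g with ⟨_ | _ | _ | k, op, args⟩
  · simp [unfOfR]
  · simp [unfOfR]
  · simp [unfOfR, Fin.sum_univ_two, add_assoc]
  · simp at hg

/-- Regrouping a sum over the gate slots that read gates by the gate read. [folklore] -/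
theorem sum_args_regroup (g : Gate (Fin N)) (L : ℕ) (F : ℕ → ℕ)
    (hwf : ∀ (a : Fin g.arity) (m : ℕ), g.args a = .inr m → m < L) :
    (∑ a : Fin g.arity, (match g.args a with | .inl _ => 0 | .inr m => F m)) =
      ∑ m ∈ range L, cnt g m * F m := by
  have hcnt : ∀ m, cnt g m * F m = ∑ a : Fin g.arity, (if g.args a = .inr m then F m else 0) := by
    intro m
    rw [cnt, card_eq_sum_ones, sum_mul, sum_filter]
    simp
  simp_rw [hcnt]
  rw [sum_comm]
  refine sum_congr rfl fun a _ => ?_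
  cases ha : g.args a with
  | inl i => simp
  | inr m₀ =>
    have hm₀ : m₀ ∈ range L := mem_range.2 (hwf a m₀ ha)
    simp only [Sum.inr.injEq]
    rw [Finset.sum_ite_eq]
    simp [hm₀]

/-- The children's values of a gate, regrouped as direct input weight plus fan-out-weighted earlier values. [folklore] -/
theorem sum_val_childR (ℓ : Fin N → ℕ) (κ : ℕ → ℕ) (gs : List (Gate (Fin N))) (g : Gate (Fin N))
    (hwf : ∀ (a : Fin g.arity) (m : ℕ), g.args a = .inr m → m < gs.length) :
    ∑ a : Fin g.arity, (childR R (unfsR R gs) (g.args a)).val ℓ κ =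
      inpR R ℓ g + ∑ m ∈ range gs.length, cnt g m * (if R (.inr m) then 0 else (UR R gs m).val ℓ κ) := by
  rw [← sum_args_regroup g gs.length _ hwf, inpR, ← sum_add_distrib]
  refine sum_congr rfl fun a _ => ?_
  rw [val_childR]
  cases g.args a with
  | inl i => simp
  | inr m => simp

/-- **The potential step**: appending a gate adds exactly its direct weight. [folklore] -/
theorem ΦR_append_singleton (ℓ : Fin N → ℕ) (κ : ℕ → ℕ) (gs : List (Gate (Fin N))) (g : Gate (Fin N))
    (hwf : WFL (gs ++ [g])) (hfo : ∀ m, R (.inr m) = false → refL (gs ++ [g]) m ≤ 1)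
    (hg : g.arity ≤ 2) :
    ΦR R ℓ κ (gs ++ [g]) = ΦR R ℓ κ gs + (κ gs.length + inpR R ℓ g) := by
  have href0 : erefL R (gs ++ [g]) gs.length = 0 := by
    simp [erefL, refL_new_eq_zero hwf]
  unfold ΦR
  rw [List.length_append, List.length_singleton, sum_range_succ, href0, Nat.sub_zero, one_mul,
    UR_append_self, val_unfOfR R ℓ κ gs g hg, sum_val_childR R ℓ κ gs g (fun a m ha => hwf.last a m ha)]
  have hterm : ∀ m ∈ range gs.length,
      (1 - erefL R (gs ++ [g]) m) * (UR R (gs ++ [g]) m).val ℓ κ +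
        cnt g m * (if R (.inr m) then 0 else (UR R gs m).val ℓ κ) =
        (1 - erefL R gs m) * (UR R gs m).val ℓ κ := by
    intro m hm
    rw [UR_append_of_lt R g (mem_range.1 hm)]
    by_cases hR : R (.inr m) = true
    · simp [erefL, hR]
    · have hfo' := hfo m (by simpa using hR)
      rw [refL_append_singleton] at hfo'
      simp only [erefL, hR, Bool.false_eq_true, if_false, refL_append_singleton]
      have hc : cnt g m = 0 ∨ (cnt g m = 1 ∧ refL gs m = 0) := by omega
      rcases hc with hc | ⟨hc, hr⟩
      · simp [hc]
      · simp [hc, hr]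
  calc ∑ m ∈ range gs.length, (1 - erefL R (gs ++ [g]) m) * (UR R (gs ++ [g]) m).val ℓ κ +
        (κ gs.length + (inpR R ℓ g +
          ∑ m ∈ range gs.length, cnt g m * (if R (.inr m) then 0 else (UR R gs m).val ℓ κ)))
      = (∑ m ∈ range gs.length, ((1 - erefL R (gs ++ [g]) m) * (UR R (gs ++ [g]) m).val ℓ κ +
          cnt g m * (if R (.inr m) then 0 else (UR R gs m).val ℓ κ))) + (κ gs.length + inpR R ℓ g) := by
        rw [sum_add_distrib]; ring
    _ = (∑ m ∈ range gs.length, (1 - erefL R gs m) * (UR R gs m).val ℓ κ) + (κ gs.length + inpR R ℓ g) := by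
        rw [sum_congr rfl hterm]

/-- **The root potential equals the total direct weight.** [folklore] -/
theorem ΦR_eq : ∀ gs : List (Gate (Fin N)), WFL gs → (∀ m, R (.inr m) = false → refL gs m ≤ 1) →
    (∀ g ∈ gs, g.arity ≤ 2) → ∀ (ℓ : Fin N → ℕ) (κ : ℕ → ℕ),
      ΦR R ℓ κ gs = (∑ j ∈ range gs.length, κ j) + (gs.map (inpR R ℓ)).sum := by
  intro gs
  induction gs using List.reverseRecOn with
  | nil => intro _ _ _ ℓ κ; simp [ΦR]
  | append_singleton gs g ih =>
    intro hwf hfo har ℓ κ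
    have hfo' : ∀ m, R (.inr m) = false → refL gs m ≤ 1 := fun m hm => by
      have := hfo m hm; rw [refL_append_singleton] at this; omega
    have har' : ∀ g' ∈ gs, g'.arity ≤ 2 := fun g' hg' => har g' (by simp [hg'])
    rw [ΦR_append_singleton R ℓ κ gs g hwf hfo (har g (by simp)), ih hwf.init hfo' har' ℓ κ]
    simp [sum_range_succ]
    ring

/-- **No duplication across root formulas**: the total valuation of the ROOT unfoldings is at
most the total direct weight. [folklore] -/
theorem sum_root_val_le (gs : List (Gate (Fin N))) (hwf : WFL gs)
    (hfo : ∀ m, R (.inr m) = false → refL gs m ≤ 1) (har : ∀ g ∈ gs, g.arity ≤ 2)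
    (ℓ : Fin N → ℕ) (κ : ℕ → ℕ) :
    ∑ m ∈ (range gs.length).filter (fun m => R (.inr m) = true), (UR R gs m).val ℓ κ ≤
      (∑ j ∈ range gs.length, κ j) + (gs.map (inpR R ℓ)).sum := by
  rw [← ΦR_eq R gs hwf hfo har ℓ κ, ΦR]
  calc ∑ m ∈ (range gs.length).filter (fun m => R (.inr m) = true), (UR R gs m).val ℓ κ
      = ∑ m ∈ (range gs.length).filter (fun m => R (.inr m) = true),
          (1 - erefL R gs m) * (UR R gs m).val ℓ κ := by
        refine sum_congr rfl fun m hm => ?_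
        simp only [mem_filter] at hm
        simp [erefL, hm.2]
    _ ≤ _ := sum_le_sum_of_subset_of_nonneg (filter_subset _ _) (fun _ _ _ => Nat.zero_le _)

/-- **Variable multiplicities across root formulas**: a non-root input occurs as a literal in all
root unfoldings together at most as often as it is read; a root input never. [folklore] -/
theorem sum_root_mult_le (gs : List (Gate (Fin N))) (hwf : WFL gs)
    (hfo : ∀ m, R (.inr m) = false → refL gs m ≤ 1) (har : ∀ g ∈ gs, g.arity ≤ 2) (p : Fin N) :
    ∑ m ∈ (range gs.length).filter (fun m => R (.inr m) = true), (UR R gs m).mult p ≤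
      (if R (.inl p) then 0 else reads gs p) := by
  have h := sum_root_val_le R gs hwf hfo har (fun q => if q = p then 1 else 0) (fun _ => 0)
  simp only [sum_const_zero, zero_add] at h
  refine h.trans ?_
  have hg : ∀ g : Gate (Fin N), inpR R (fun q => if q = p then 1 else 0) g ≤
      (if R (.inl p) then 0 else cntI g p) := by
    intro g
    unfold inpR cntI
    rw [card_eq_sum_ones, sum_filter]
    split_ifs with hR
    · refine (sum_eq_zero fun a _ => ?_).le
      cases ha : g.args a with
      | inl i =>
        by_cases hip : i = p
        · subst hip; simp [hR]
        · simp [hip]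
      | inr m => simp
    · refine sum_le_sum fun a _ => ?_
      cases ha : g.args a with
      | inl i =>
        by_cases hip : i = p
        · subst hip; simp [hR]
        · have : ¬ (Sum.inl i : Fin N ⊕ ℕ) = Sum.inl p := by simpa using hip
          simp [hip, this]
      | inr m => simp
  refine (List.sum_le_sum (fun g _ => hg g)).trans ?_
  split_ifs with hR
  · simp
  · exact le_of_eq rfl

/-- **Gate-node multiplicities across root formulas**: every gate index occurs at most once in
all root unfoldings together. [folklore] -/
theorem sum_root_gmult_le (gs : List (Gate (Fin N))) (hwf : WFL gs)
    (hfo : ∀ m, R (.inr m) = false → refL gs m ≤ 1) (har : ∀ g ∈ gs, g.arity ≤ 2) (j₀ : ℕ) :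
    ∑ m ∈ (range gs.length).filter (fun m => R (.inr m) = true), (UR R gs m).gmult j₀ ≤ 1 := by
  have h := sum_root_val_le R gs hwf hfo har (fun _ => 0) (fun j => if j = j₀ then 1 else 0)
  have hinp : ∀ g : Gate (Fin N), inpR R (fun _ => 0) g = 0 := fun g => by
    unfold inpR
    refine sum_eq_zero fun a _ => ?_
    cases g.args a <;> simp
  have hsum : (gs.map (inpR R fun _ => 0)).sum = 0 := by
    rw [List.sum_eq_zero]
    intro x hx
    obtain ⟨g, -, rfl⟩ := List.mem_map.1 hx
    exact hinp g
  rw [hsum, add_zero, sum_ite_eq'] at h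
  refine h.trans ?_
  split_ifs <;> simp

end BF

end Potential

end Summit.PneNP.PneNP.Theorems.GapMCSPWindowCellZero
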